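import Literature.AlgebraicGeometry.Ramification.InertiaNormalSylowBlowup
import Mathlib.AlgebraicGeometry.Limits
import HarnessLib

/-!
# Galois torsors (Abbes–Saito 2011, 2.3) and the base change of property (NpS) (Lemma 2.15)

Topic: `Literature/AlgebraicGeometry/Ramification`. Companion of `InertiaNormalSylow.lean`
(Abbes–Saito's property (NpS), Def. 2.12) and `InertiaNormalSylowBlowup.lean` (the named fact
`AbbesSaito2011_inertiaNormalSylow_after_admissibleBlowup` = Prop. 2.22: after a `U`-admissible
blow-up, (NpS) holds everywhere). Numbering of arXiv:1007.3873v3 = Tohoku Math. J. 63 (2011).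

> **2.3.** Let `X` be a locally noetherian scheme. In this article, a Galois torsor over `X` of
> group `G` stands for a torsor over `X` for the étale topology under a finite constant group
> `G`, that is, a principal covering of `X` of Galois group `G` in the sense of ([SGA 1] V 2.8).
>
> **Lemma 2.15.** Let `X, X'` be normal, locally noetherian and universally Japanese schemes,
> `U` a dense open subscheme of `X`, `V` a Galois torsor over `U` of group `G`, `Y` the integral
> closure of `X` in `V`, `f : X' → X` a morphism, `U' = f⁻¹(U)`, `V' = U' ×_U V`, `Y'` the
> integral closure of `X'` in `V'`, `g : Y' → Y` the canonical morphism, `ȳ'` a geometric point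
> of `Y'`, `ȳ = g(ȳ')`, `x̄'` the image of `ȳ'` in `X'`, `x̄ = f(x̄')`, and `I_ȳ` and `I_{ȳ'}` the
> inertia groups of `ȳ` and `ȳ'`, respectively. Then `I_{ȳ'} ⊂ I_ȳ`. In particular, if `V/U`
> has the property (NpS) at `x̄`, `V'/U'` has the property (NpS) at `x̄'`.

## Content (namespace `Literature.AlgebraicGeometry.Ramification`)

* `actionMap f ρ hρ : ∐_{g ∈ G} V → V ×_X V`, `(g, v) ↦ (g v, v)` — the action map of a finite group
  `G` acting by `ρ : G →* Aut V` on `V` over `X` (`hρ`).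
* `IsGaloisTorsor f U ρ` — "`V` is a Galois torsor over the open `U ⊆ X` of group `G`, through
  `f : V → X`" (AS2011 2.3, SGA 1 V 2.8): `G` acts over `X`, `f` is étale with image exactly
  `U`, and the action map is an ISOMORPHISM `∐_G V ⥲ V ×_X V = V ×_U V` (so `V → U` is a
  `G`-torsor trivialised by itself). These are VERBATIM the torsor hypotheses of the named fact
  `AbbesSaito2011_inertiaNormalSylow_after_admissibleBlowup` (`InertiaNormalSylowBlowup.lean`),
  now a named predicate: `IsGaloisTorsor.exists_admissibleBlowup` feeds it. PROVED consequences: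
  `G` acts SIMPLY TRANSITIVELY on the `K`-points of every fibre, for every field `K`
  (`exists_comp_hom_eq`, `eq_of_comp_hom_eq`, `existsUnique_comp_hom_eq` — points of `V ×_X V`
  with values in a field lift to a summand of `∐_G V`), hence all inertia groups of `G` on `V`
  itself are trivial (`inertiaSubgroup_eq_bot`: the cover is unramified over `U`; ramification
  lives on the integral closure `Y ⊇ V` of `X`).
* `AbbesSaito2011_inertiaNormalSylowAt_baseChange` — NAMED FACT, **Lemma 2.15** ("in particular"
  clause): (NpS) at `f(x̄')` for `V/U` implies (NpS) at `x̄'` for `V' = U' ×_U V = X' ×_X V` over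
  `X'`, for ANY morphism `f : X' → X` with `X'` normal — the step by which AS2011 Prop. 7.22
  moves (NpS) from the blown-up base of Prop. 2.22 to a regular (snc) model. Same special case as
  the Prop. 2.22 fact (schemes locally of finite type over a field: locally noetherian and
  universally Japanese, AS2011 2.5; no characteristic hypothesis is needed here); the base change
  `V'` is given as any cartesian square `IsPullback q f' fV f` with an action `ρ'` of `G` on `V'`
  over `X'` making `q : V' → V` equivariant (the induced action: `(q, f')` is jointly
  monomorphic). -- TODO(general form): the inclusion `I_{ȳ'} ⊆ I_ȳ` itself (needs the canonical
  -- `g : Y' → Y ×_X X' → Y`); `X, X'` normal locally noetherian universally Japanese in general.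

## References

* A. Abbes, T. Saito, *Ramification and cleanliness*, Tohoku Math. J. (2) 63 (2011), 775–853
  (= arXiv:1007.3873v3): 2.3, 2.4, 2.5, Def. 2.12, Lemma 2.15, Prop. 2.22, Prop. 7.22.
  [AbbesSaito2011]
* A. Grothendieck, *SGA 1*, Exp. V, 2.8 (principal coverings). [SGA1]
-/

noncomputable section

open CategoryTheory CategoryTheory.Limits AlgebraicGeometry

namespace Literature.AlgebraicGeometry.Ramification

universe u

open Literature.AlgebraicGeometry.Resolution

/-! ## The action map and Galois torsors (AS2011 2.3) -/

section GaloisTorsor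

variable {G : Type u} [Group G] {V X : Scheme.{u}} (f : V ⟶ X) (ρ : G →* Aut V)
  (hρ : ∀ g : G, (ρ g).hom ≫ f = f)

/-- The **action map** `∐_{g ∈ G} V → V ×_X V`, `(g, v) ↦ (g·v, v)`, of a group `G` acting by
`ρ` on `V` over `X`. [folklore] -/
def actionMap : (∐ fun _ : G => V) ⟶ pullback f f :=
  Sigma.desc fun g : G => pullback.lift (ρ g).hom (𝟙 V) ((hρ g).trans (Category.id_comp f).symm)

/-- The `g`-th component of the action map is `v ↦ (g·v, v)`. [folklore] -/
@[reassoc (attr := simp)]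
theorem ι_actionMap (g : G) :
    Sigma.ι (fun _ : G => V) g ≫ actionMap f ρ hρ =
      pullback.lift (ρ g).hom (𝟙 V) ((hρ g).trans (Category.id_comp f).symm) :=
  Sigma.ι_desc _ _

variable {f ρ}

/-- **Galois torsor** over the open `U ⊆ X` of group `G`, through `f : V → X` (Abbes–Saito 2011,
2.3: "a torsor over `U` for the étale topology under a finite constant group `G`, that is, a
principal covering of `U` of Galois group `G` in the sense of SGA 1 V 2.8"), rendered — verbatim
as in the hypotheses of `AbbesSaito2011_inertiaNormalSylow_after_admissibleBlowup` — by: `G` acts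
on `V` by `ρ` over `X`, `f` is ÉTALE with image EXACTLY `U`, and the action map
`∐_{g ∈ G} V → V ×_X V = V ×_U V` is an ISOMORPHISM (then `V → U` is a `G`-torsor for the étale
topology trivialised by the étale surjection `V → U` itself, hence finite étale; conversely a
principal covering has these properties). Intended for `G` finite. [cite: AbbesSaito2011, 2.3] -/
structure IsGaloisTorsor (f : V ⟶ X) (U : X.Opens) (ρ : G →* Aut V) : Prop where
  /-- `G` acts over `X` -/
  hom_comp_eq : ∀ g : G, (ρ g).hom ≫ f = f
  /-- `V → X` is étale -/
  etale : Etale f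
  /-- with image the open `U` -/
  range_eq : Set.range f = (U : Set X)
  /-- and `(g, v) ↦ (g·v, v) : ∐_G V → V ×_X V` is an isomorphism -/
  isIso_actionMap : IsIso (actionMap f ρ hom_comp_eq)

namespace IsGaloisTorsor

variable {U : X.Opens}

/-- The action is over any further base. [folklore] -/
theorem hom_comp_comp_eq (h : IsGaloisTorsor f U ρ) {S : Scheme.{u}} (i : X ⟶ S) (g : G) :
    (ρ g).hom ≫ f ≫ i = f ≫ i := by
  rw [← Category.assoc, h.hom_comp_eq]

/-- **Transitivity on points of the fibres**: two `K`-points of `V` (`K` any field) with the same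
image in `X` differ by an element of `G` — the point `(w, v)` of `V ×_X V` comes from a point of
a summand `g` of `∐_G V`. [cite: SGA1, Exp. V 2.8] -/
theorem exists_comp_hom_eq (h : IsGaloisTorsor f U ρ) {K : Type u} [Field K]
    (v w : Spec (.of K) ⟶ V) (hvw : v ≫ f = w ≫ f) : ∃ g : G, v ≫ (ρ g).hom = w := by
  haveI := h.isIso_actionMap
  -- the point `(w, v)` of `V ×_X V`, pulled back to `∐_G V`
  set t : Spec (.of K) ⟶ pullback f f := pullback.lift w v hvw.symm with ht
  set s : Spec (.of K) ⟶ ∐ fun _ : G => V := t ≫ inv (actionMap f ρ h.hom_comp_eq) with hs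
  have hst : s ≫ actionMap f ρ h.hom_comp_eq = t := by simp [hs]
  -- `s` factors through a summand `g`
  obtain ⟨⟨g, y⟩, hy⟩ := (sigmaMk fun _ : G => V).surjective (s (IsLocalRing.closedPoint K))
  rw [sigmaMk_mk] at hy
  have hrange : Set.range s ⊆ Set.range (Sigma.ι (fun _ : G => V) g) := by
    rintro _ ⟨pt, rfl⟩
    obtain rfl : pt = IsLocalRing.closedPoint K := Subsingleton.elim _ _
    exact ⟨y, hy⟩
  haveI : IsOpenImmersion (Sigma.ι (fun _ : G => V) g) :=
    (sigmaOpenCover fun _ : G => V).map_prop g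
  set s' := IsOpenImmersion.lift (Sigma.ι (fun _ : G => V) g) s hrange with hs'
  have hfac : s' ≫ Sigma.ι (fun _ : G => V) g = s := IsOpenImmersion.lift_fac _ _ _
  have ht' : t = s' ≫ pullback.lift (ρ g).hom (𝟙 V)
      ((h.hom_comp_eq g).trans (Category.id_comp f).symm) := by
    rw [← ι_actionMap f ρ h.hom_comp_eq g, ← Category.assoc, hfac, hst]
  refine ⟨g, ?_⟩
  have hv : v = s' := by
    have h1 : t ≫ pullback.snd f f = v := by rw [ht, pullback.lift_snd]
    rw [← h1, ht', Category.assoc, pullback.lift_snd, Category.comp_id]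
  have hw : w = s' ≫ (ρ g).hom := by
    have h1 : t ≫ pullback.fst f f = w := by rw [ht, pullback.lift_fst]
    rw [← h1, ht', Category.assoc, pullback.lift_fst]
  rw [hv, hw]

/-- **Freeness**: if `g·v = g'·v` for a point `v` of `V` with values in a non-empty scheme `T`
(e.g. a `K`-point, `K` a field) then `g = g'` — the summands of `∐_G V` are disjoint and the
action map is a monomorphism. [cite: SGA1, Exp. V 2.8] -/
theorem eq_of_comp_hom_eq (h : IsGaloisTorsor f U ρ) {T : Scheme.{u}} [Nonempty T] (v : T ⟶ V)
    {g g' : G} (hg : v ≫ (ρ g).hom = v ≫ (ρ g').hom) : g = g' := by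
  haveI := h.isIso_actionMap
  have hι : v ≫ Sigma.ι (fun _ : G => V) g = v ≫ Sigma.ι (fun _ : G => V) g' := by
    rw [← cancel_mono (actionMap f ρ h.hom_comp_eq), Category.assoc, Category.assoc,
      ι_actionMap, ι_actionMap]
    apply pullback.hom_ext
    · rw [Category.assoc, Category.assoc, pullback.lift_fst, pullback.lift_fst, hg]
    · rw [Category.assoc, Category.assoc, pullback.lift_snd, pullback.lift_snd]
  by_contra hne
  exact (isEmpty_of_commSq_sigmaι_of_ne ⟨hι⟩ hne).false (Classical.arbitrary T)

/-- **`G` acts simply transitively on the points of every fibre** (with values in any field, in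
particular on geometric fibres). [cite: SGA1, Exp. V 2.8] -/
theorem existsUnique_comp_hom_eq (h : IsGaloisTorsor f U ρ) {K : Type u} [Field K]
    (v w : Spec (.of K) ⟶ V) (hvw : v ≫ f = w ≫ f) : ∃! g : G, v ≫ (ρ g).hom = w := by
  obtain ⟨g, hg⟩ := h.exists_comp_hom_eq v w hvw
  exact ⟨g, hg, fun g' hg' => h.eq_of_comp_hom_eq v (hg'.trans hg.symm)⟩

/-- An element of `G` fixing a point of `V` (with values in a non-empty scheme) is trivial.
[folklore] -/
theorem eq_one_of_comp_hom_eq (h : IsGaloisTorsor f U ρ) {T : Scheme.{u}} [Nonempty T]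
    (v : T ⟶ V) {g : G} (hg : v ≫ (ρ g).hom = v) : g = 1 :=
  h.eq_of_comp_hom_eq v (by rw [hg, map_one, aut_one_hom, Category.comp_id])

/-- On `V` itself all inertia groups of `G` are trivial (the cover is unramified over `U`; the
ramification of `V/U` lives on the integral closure `Y ⊇ V` of `X` in `V`). [folklore] -/
theorem inertiaSubgroup_eq_bot (h : IsGaloisTorsor f U ρ) (v : V) : inertiaSubgroup ρ v = ⊥ := by
  rw [eq_bot_iff]
  intro g hg
  rw [Subgroup.mem_bot]
  exact h.eq_one_of_comp_hom_eq (V.fromSpecResidueField v) hg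

/-- The named fact `AbbesSaito2011_inertiaNormalSylow_after_admissibleBlowup` (AS2011 Prop. 2.22,
`InertiaNormalSylowBlowup.lean`) applies to a Galois torsor in the present sense: its torsor
hypotheses are the fields of `IsGaloisTorsor`. [cite: AbbesSaito2011, Prop. 2.22] -/
theorem exists_admissibleBlowup (hAS : AbbesSaito2011_inertiaNormalSylow_after_admissibleBlowup.{u})
    {p : ℕ} [Fact p.Prime] {k : Type u} [Field k] [CharP k p] {sX : X ⟶ Spec (.of k)}
    (hft : LocallyOfFiniteType sX)
    (hN : ∀ x : X, IsDomain (X.presheaf.stalk x) ∧ IsIntegrallyClosed (X.presheaf.stalk x))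
    (hU : Dense (U : Set X)) [Finite G] (h : IsGaloisTorsor f U ρ) :
    ∃ (X' : Scheme.{u}) (φ : X' ⟶ X) (I : X.IdealSheafData),
      IsBlowup φ I ∧ (∀ W : X.affineOpens, (I.ideal W).FG) ∧
      Disjoint (U : Set X) (I.support : Set X) ∧
      ∃ (f' : V ⟶ X') (_ : QuasiCompact f') (_ : QuasiSeparated f')
        (hρ' : ∀ g, (ρ g).hom ≫ f' = f'),
        f' ≫ φ = f ∧ InertiaNormalSylow p f' ρ hρ' :=
  hAS p k X sX hft hN U hU G V f ρ h.hom_comp_eq h.etale h.range_eq h.isIso_actionMap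

end IsGaloisTorsor

end GaloisTorsor

/-! ## (NpS) is stable under base change (AS2011 Lemma 2.15) -/

/-- NAMED FACT — **Abbes–Saito 2011, Lemma 2.15** ("in particular" clause; Lemma 10 in the flat
arXiv numbering): "Let `X, X'` be normal, locally noetherian and universally Japanese schemes,
`U` a dense open subscheme of `X`, `V` a Galois torsor over `U` of group `G`, `Y` the integral
closure of `X` in `V`, `f : X' → X` a morphism, `U' = f⁻¹(U)`, `V' = U' ×_U V`, `Y'` the integral
closure of `X'` in `V'` […], `x̄'` the image of `ȳ'` in `X'`, `x̄ = f(x̄')` […]. Then `I_{ȳ'} ⊂ I_ȳ`.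
In particular, if `V/U` has the property (NpS) at `x̄`, `V'/U'` has the property (NpS) at `x̄'`."
(Proof: the `G`-equivariant `X'_(x̄') ×_{X'} V' → X_(x̄) ×_X V` on strict localisations maps the
connected component of `ȳ'` into that of `ȳ`, and the inertia groups are the stabilisers of these
components, 2.4; a subgroup of a group with a normal `p`-Sylow has one.)

Stated: the "in particular" clause, in the special case and the conventions of the Prop. 2.22
fact `AbbesSaito2011_inertiaNormalSylow_after_admissibleBlowup`: `X`, `X'` NORMAL schemes locally
of finite type over a field `k` (locally noetherian and universally Japanese, AS2011 2.5; no
characteristic hypothesis is needed for 2.15), `U ⊆ X` a dense open, `V` a Galois torsor over `U`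
of finite group `G` through `fV : V → X` (`IsGaloisTorsor`), `f : X' → X` ANY morphism, and the
base change `V' = U' ×_U V = X' ×_X V → X'` given as any cartesian square `IsPullback q f' fV f`
with an action `ρ'` of `G` on `V'` over `X'` for which `q : V' → V` is equivariant (the induced
action; `(q, f')` is jointly monomorphic). Conclusion: (NpS) for `V/U` at `f(x')`
(`InertiaNormalSylowAt`, at the point a geometric point `x̄'` localises at) implies (NpS) for
`V'/U'` at `x'`. -- TODO(general form): the inclusion `I_{ȳ'} ⊆ I_ȳ` itself (needs the
-- canonical `g : Y' → Y ×_X X' → Y`); `X, X'` normal loc. noetherian univ. Japanese in general.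
[cite: AbbesSaito2011, Lemma 2.15] -/
def AbbesSaito2011_inertiaNormalSylowAt_baseChange : Prop :=
  ∀ (p : ℕ) (k : Type u) [Field k]
    -- the normal `k`-schemes `X`, `X'`, locally of finite type, and the dense open `U ⊆ X`
    (X X' : Scheme.{u}) (sX : X ⟶ Spec (.of k)) (sX' : X' ⟶ Spec (.of k)),
    LocallyOfFiniteType sX → LocallyOfFiniteType sX' →
    (∀ x : X, IsDomain (X.presheaf.stalk x) ∧ IsIntegrallyClosed (X.presheaf.stalk x)) →
    (∀ x' : X', IsDomain (X'.presheaf.stalk x') ∧ IsIntegrallyClosed (X'.presheaf.stalk x')) →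
    ∀ (U : X.Opens), Dense (U : Set X) →
    -- the Galois torsor `V → U` of group `G`, through `fV : V → X`
    ∀ (G : Type u) [Group G] [Finite G] (V : Scheme.{u}) (fV : V ⟶ X) [QuasiCompact fV]
      [QuasiSeparated fV] (ρ : G →* Aut V) (hV : IsGaloisTorsor fV U ρ)
    -- the base change `V' = X' ×_X V → X'` along `f`, with its `G`-action
      (f : X' ⟶ X) (V' : Scheme.{u}) (q : V' ⟶ V) (f' : V' ⟶ X') [QuasiCompact f']
      [QuasiSeparated f'], IsPullback q f' fV f →
    ∀ (ρ' : G →* Aut V'), (∀ g : G, (ρ' g).hom ≫ q = q ≫ (ρ g).hom) →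
    ∀ (hρ' : ∀ g : G, (ρ' g).hom ≫ f' = f') (x' : X'),
    -- conclusion
      InertiaNormalSylowAt p fV ρ hV.hom_comp_eq (f x') → InertiaNormalSylowAt p f' ρ' hρ' x'

end Literature.AlgebraicGeometry.Ramification

end
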